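import Mathlib.Analysis.Calculus.BumpFunction.FiniteDimension
import Mathlib.Analysis.Calculus.BumpFunction.InnerProduct
import Mathlib.Analysis.Calculus.ContDiff.Bounds
import Mathlib.Analysis.InnerProductSpace.EuclideanDist
import HarnessLib

/-!
# Scaled smooth cut-off functions with derivative bounds `‖Dⁿφ‖ ≤ Cₙ r⁻ⁿ`

The standard cut-off family of PDE analysis ("fix a cutoff `φ₁` for `B₁ ⊂ B₂` and put
`φ_r(x) = φ₁(x/r)`", e.g. Waldron 2019, §2 before (2.6); Struwe 1994, §3): on a finite-dimensional
real normed space with smooth bump functions there is a family `φ_{x₀,r} : E → [0,1]`, `r > 0`,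
of `C^∞` functions with `φ_{x₀,r} = 1` on the closed ball `B̄_r(x₀)`, `φ_{x₀,r} = 0` off the open
ball `B_{2r}(x₀)`, and **scale-invariant derivative bounds** `‖Dⁿ φ_{x₀,r}(y)‖ ≤ Cₙ / rⁿ` for all
`n`, with constants `Cₙ` independent of `x₀` and `r`; all derivatives of positive order vanish
off the closed annulus `B̄_{2r}(x₀) ∖ B_r(x₀)`.

* `exists_smooth_cutoff_family` — the family and all its properties (one existential statement;
  the family is `φ_{x₀,r}(y) = φ₁(r⁻¹(y − x₀))` for a fixed bump `φ₁`).

[folklore]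
-/

noncomputable section

open Set Metric Filter Function
open scoped Topology ContDiff

namespace Literature.Analysis.Calculus

variable {E : Type*} [NormedAddCommGroup E] [NormedSpace ℝ E] [HasContDiffBump E]
  [FiniteDimensional ℝ E]

/-- **Scaled smooth cut-offs with derivative bounds.** There are a family of functions
`φ x₀ r : E → ℝ` (`x₀ : E`, `r > 0`) and constants `C n ≥ 0` such that each `φ x₀ r` is `C^∞`,
takes values in `[0, 1]`, equals `1` on the closed ball `closedBall x₀ r`, vanishes on
`{2r ≤ dist y x₀}` (so `tsupport ⊆ closedBall x₀ (2r)`, compact), all its derivatives of order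
`n ≥ 1` vanish on the open ball `ball x₀ r` and on `{2r < dist y x₀}`, and
`‖iteratedFDeriv ℝ n (φ x₀ r) y‖ ≤ C n / r ^ n` for every `n` and `y` (scaling of one fixed bump
function `φ₁` for `B̄₁ ⊂ B₂`: `φ x₀ r y = φ₁ (r⁻¹ (y − x₀))`). [folklore] -/
theorem exists_smooth_cutoff_family :
    ∃ (φ : E → ℝ → E → ℝ) (C : ℕ → ℝ), (∀ n, 0 ≤ C n) ∧ ∀ (x₀ : E) (r : ℝ), 0 < r →
      ContDiff ℝ ∞ (φ x₀ r) ∧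
      (∀ y, 0 ≤ φ x₀ r y) ∧ (∀ y, φ x₀ r y ≤ 1) ∧
      (∀ y, dist y x₀ ≤ r → φ x₀ r y = 1) ∧
      (∀ y, 2 * r ≤ dist y x₀ → φ x₀ r y = 0) ∧
      tsupport (φ x₀ r) ⊆ closedBall x₀ (2 * r) ∧ HasCompactSupport (φ x₀ r) ∧
      (∀ n, 1 ≤ n → ∀ y, dist y x₀ < r ∨ 2 * r < dist y x₀ →
        iteratedFDeriv ℝ n (φ x₀ r) y = 0) ∧
      (∀ y, dist y x₀ < r ∨ 2 * r < dist y x₀ → fderiv ℝ (φ x₀ r) y = 0) ∧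
      (∀ (n : ℕ) y, ‖iteratedFDeriv ℝ n (φ x₀ r) y‖ ≤ C n / r ^ n) := by
  -- a fixed bump for `closedBall 0 1 ⊂ ball 0 2`
  let b : ContDiffBump (0 : E) := ⟨1, 2, one_pos, one_lt_two⟩
  have hb : ContDiff ℝ ∞ b := b.contDiff
  -- uniform bounds on all derivatives of the fixed bump
  have hM : ∀ n : ℕ, ∃ M : ℝ, ∀ y, ‖iteratedFDeriv ℝ n b y‖ ≤ M := fun n =>
    ((hb.continuous_iteratedFDeriv (by exact_mod_cast le_top)).bounded_above_of_compact_support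
      (b.hasCompactSupport.iteratedFDeriv (𝕜 := ℝ) n))
  choose M hM using hM
  -- the family
  refine ⟨fun x₀ r y => b (r⁻¹ • (y - x₀)), fun n => max (M n) 0, fun n => le_max_right _ _,
    fun x₀ r hr => ?_⟩
  have hrinv : 0 < r⁻¹ := inv_pos.mpr hr
  -- the rescaling map and the norm of rescaled points
  set g : E →L[ℝ] E := r⁻¹ • ContinuousLinearMap.id ℝ E with hg
  have hg_apply : ∀ z, g z = r⁻¹ • z := fun z => rfl
  have hg_norm : ‖g‖ ≤ r⁻¹ := by
    rw [hg, norm_smul, Real.norm_eq_abs, abs_of_pos hrinv]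
    exact mul_le_of_le_one_right hrinv.le ContinuousLinearMap.norm_id_le
  have hnorm : ∀ y : E, ‖r⁻¹ • (y - x₀)‖ = r⁻¹ * dist y x₀ := fun y => by
    rw [norm_smul, Real.norm_eq_abs, abs_of_pos hrinv, dist_eq_norm]
  -- the family as a composition `b ∘ g ∘ (· - x₀)`
  have hcomp : (fun y : E => b (r⁻¹ • (y - x₀))) = fun y => (b ∘ g) (y - x₀) := by
    funext y; simp [hg_apply]
  have hsmooth : ContDiff ℝ ∞ (fun y : E => b (r⁻¹ • (y - x₀))) := by
    rw [hcomp]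
    exact (hb.comp g.contDiff).comp (contDiff_id.sub contDiff_const)
  -- values
  have hone : ∀ y, dist y x₀ ≤ r → b (r⁻¹ • (y - x₀)) = 1 := by
    intro y hy
    refine b.one_of_mem_closedBall ?_
    rw [mem_closedBall_zero_iff, hnorm]
    calc r⁻¹ * dist y x₀ ≤ r⁻¹ * r := mul_le_mul_of_nonneg_left hy hrinv.le
      _ = 1 := inv_mul_cancel₀ hr.ne'
  have hzero : ∀ y, 2 * r ≤ dist y x₀ → b (r⁻¹ • (y - x₀)) = 0 := by
    intro y hy
    refine b.zero_of_le_dist ?_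
    rw [dist_zero_right, hnorm]
    calc (b.rOut : ℝ) = r⁻¹ * (2 * r) := by
          change (2 : ℝ) = r⁻¹ * (2 * r); field_simp
      _ ≤ r⁻¹ * dist y x₀ := mul_le_mul_of_nonneg_left hy hrinv.le
  -- support
  have htsupp : tsupport (fun y : E => b (r⁻¹ • (y - x₀))) ⊆ closedBall x₀ (2 * r) := by
    refine closure_minimal ?_ isClosed_closedBall
    intro y hy
    rw [mem_closedBall]
    by_contra h
    exact hy (hzero y (le_of_lt (not_le.mp h)))
  have hcpt : HasCompactSupport (fun y : E => b (r⁻¹ • (y - x₀))) :=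
    IsCompact.of_isClosed_subset (isCompact_closedBall x₀ (2 * r)) (isClosed_tsupport _) htsupp
  -- local constancy off the annulus
  have hloc : ∀ y, dist y x₀ < r ∨ 2 * r < dist y x₀ →
      ∃ c : ℝ, (fun y : E => b (r⁻¹ • (y - x₀))) =ᶠ[𝓝 y] fun _ => c := by
    rintro y (hy | hy)
    · refine ⟨1, ?_⟩
      have hopen : IsOpen {z : E | dist z x₀ < r} := isOpen_lt (continuous_id.dist continuous_const)
          continuous_const
      filter_upwards [hopen.mem_nhds hy] with z hz
      exact hone z (le_of_lt hz)
    · refine ⟨0, ?_⟩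
      have hopen : IsOpen {z : E | 2 * r < dist z x₀} :=
        isOpen_lt continuous_const (continuous_id.dist continuous_const)
      filter_upwards [hopen.mem_nhds hy] with z hz
      exact hzero z (le_of_lt hz)
  have hiter0 : ∀ n, 1 ≤ n → ∀ y, dist y x₀ < r ∨ 2 * r < dist y x₀ →
      iteratedFDeriv ℝ n (fun y : E => b (r⁻¹ • (y - x₀))) y = 0 := by
    intro n hn y hy
    obtain ⟨c, hc⟩ := hloc y hy
    rw [(hc.iteratedFDeriv ℝ n).eq_of_nhds, iteratedFDeriv_const_of_ne (by omega)]
    rfl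
  have hfderiv0 : ∀ y, dist y x₀ < r ∨ 2 * r < dist y x₀ →
      fderiv ℝ (fun y : E => b (r⁻¹ • (y - x₀))) y = 0 := by
    intro y hy
    obtain ⟨c, hc⟩ := hloc y hy
    rw [hc.fderiv_eq]
    exact fderiv_const_apply c
  -- the derivative bounds by scaling
  have hbound : ∀ (n : ℕ) y,
      ‖iteratedFDeriv ℝ n (fun y : E => b (r⁻¹ • (y - x₀))) y‖ ≤ max (M n) 0 / r ^ n := by
    intro n y
    rw [hcomp, iteratedFDeriv_comp_sub, g.iteratedFDeriv_comp_right hb _ (by exact_mod_cast le_top)]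
    calc ‖(iteratedFDeriv ℝ n b (g (y - x₀))).compContinuousLinearMap fun _ => g‖
        ≤ ‖iteratedFDeriv ℝ n b (g (y - x₀))‖ * ∏ _i : Fin n, ‖g‖ :=
          ContinuousMultilinearMap.norm_compContinuousLinearMap_le _ _
      _ ≤ max (M n) 0 * (r⁻¹) ^ n := by
          rw [Finset.prod_const, Finset.card_univ, Fintype.card_fin]
          refine mul_le_mul ((hM n _).trans (le_max_left _ _)) ?_ (by positivity)
            (le_max_right _ _)
          exact pow_le_pow_left₀ (norm_nonneg _) hg_norm n
      _ = max (M n) 0 / r ^ n := by rw [inv_pow, div_eq_mul_inv]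
  exact ⟨hsmooth, fun y => b.nonneg, fun y => b.le_one, hone, hzero, htsupp, hcpt, hiter0,
    hfderiv0, hbound⟩

end Literature.Analysis.Calculus
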